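import Summits.QuantumFields.YangMills.Theorems.ForcedResponseSkewnessResponseLocalisationSignedGeometry
import Summits.QuantumFields.YangMills.Theorems.ForcedResponseSkewnessResponseLocalisationSmearedDefs
import Summits.QuantumFields.YangMills.Theorems.ForcedResponseSkewnessResponseLocalisationStubCollarOfKernel
import Summits.QuantumFields.YangMills.Theorems.BalabanLadderNTCanonicalEnvelopes
import Summits.QuantumFields.YangMills.Theorems.ForcedResponseSkewnessResponseLocalisationContactOfFemtoCumulant
import HarnessLib

/-!
# Crux `ResponseLocalisation` (stmt-QuantumFields-24869 → rev 6), line «signed-femto-collar»: registered stub `stub_signedOfSymKernel`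

`Summit.QuantumFields.YangMills.Cruxes.ResponseLocalisation.Signed.stub_signedOfSymKernel : SignedOfSymKernelSigR` (Defs p613181) — the
crux-level ANALYSIS stub of the line of record (lead `ym-line-frs-p1` g4; design: seat `ym-line-frs-p2`, evidence #23): the torus-level
signed radial collar kernel `SymContactKernelSigR` and the frozen-boundary law along the pinned unit imply the rev-6 crux body — the SIGNED
smooth-collar share `|Σ_x χ(l·aβ·x) respM x| ≤ η(1+|∂_cQ2|)` for a `[0,1]`-valued Schwartz cut-off `χ` equal to `1` on a thickening of
`tsupport v ∪ tsupport θv` and vanishing off a ball.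

Proof: `χ = F(‖· − p‖) + F(‖· − θp‖)` (`Signed.exists_signed_cutoff`, radius `R = min R_K (p₀/4)`).  Per charged pair `(y,z)`:
`χ(s x) = F(s‖x − z‖) + F(s‖x − y‖) + d_z(x) + d_y(x)`; the two radial parts are weights of `SymContactKernelSigR` (`κ a⁸` each, the
`θ`-side via `torusK3_swap`); the offsets have sup `≤ Lip(F)·ρ` and live on the shells `R/4 ≤ s‖x − z‖ ≤ 5R/4` (resp. `y`), where
`Signed.abs_torusK3_le_shell` gives `|κ₃| ≤ (2C₁/M⁴)³ ≤ A₀ a¹²` per site and `Signed.card_filter_norm_sub_le` counts `≤ (5R/a)⁴` sites,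
so `ρ ≤ κ/(625·Lip(F)·A₀R⁴ + 1)` makes each offset `≤ κ a⁸`.  Riemann sums `s⁴Σ|v(s·)|, s⁴Σ|θv(s·)| ≤ 2` give `≤ 16κ = η/4`.

Honest label: ONE analysis stub of a CONDITIONAL rung line (leaf R2a `BalabanLadder.NT`); the physics stubs (`stub_symNearCovLaw` AF,
`stub_fbl6Pinned` E0′), the crux, NT and the Yang–Mills mass gap are NOT proved by any of this.
-/

set_option autoImplicit false

noncomputable section

namespace Summit.QuantumFields.YangMills.Cruxes.ResponseLocalisation.Signed

open Filter Topology Metric MeasureTheory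
open scoped SchwartzMap
open Literature.MathematicalPhysics.QuantumFieldTheory
open Literature.MathematicalPhysics.QuantumLattice hiding torusDist
open Literature.Probability.LatticeModels
open Summit.QuantumFields.YangMills.Cruxes.OSLegsFromFemtoAndGap.DlrCollarTransfer
open Summit.QuantumFields.YangMills.Cruxes.RunningCouplingCeiling.Pointwise
open Summit.QuantumFields.YangMills.Cruxes.ResponseLocalisation.Birth
open Summit.QuantumFields.YangMills.Cruxes.ResponseLocalisation.Far
open Summit.QuantumFields.YangMills.Cruxes.ResponseLocalisation.Collar

/-- Double smearing of a per-pair bound: if `|K y z| ≤ B` whenever `f y ≠ 0` and `g z ≠ 0`, then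
`|Σ_y Σ_z f(y) g(z) K(y,z)| ≤ (Σ_y |f y|)·(Σ_z |g z|)·B` (kept apart so the main proof stays in the default heartbeat budget). [folklore] -/
theorem abs_sum_sum_mul_mul_le {ι : Type*} (S : Finset ι) (f g : ι → ℝ) (K : ι → ι → ℝ) {B : ℝ}
    (hK : ∀ y ∈ S, ∀ z ∈ S, f y ≠ 0 → g z ≠ 0 → |K y z| ≤ B) :
    |∑ y ∈ S, ∑ z ∈ S, f y * g z * K y z| ≤ (∑ y ∈ S, |f y|) * (∑ z ∈ S, |g z|) * B := by
  calc |∑ y ∈ S, ∑ z ∈ S, f y * g z * K y z| ≤ ∑ y ∈ S, ∑ z ∈ S, |f y| * |g z| * B := by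
        refine (Finset.abs_sum_le_sum_abs _ _).trans (Finset.sum_le_sum fun y hy => ?_)
        refine (Finset.abs_sum_le_sum_abs _ _).trans (Finset.sum_le_sum fun z hz => ?_); rw [abs_mul, abs_mul]
        by_cases hfy : f y = 0
        · simp only [hfy, abs_zero, zero_mul, le_refl]
        by_cases hgz : g z = 0
        · simp only [hgz, abs_zero, mul_zero, zero_mul, le_refl]
        exact mul_le_mul_of_nonneg_left (hK y hy z hz hfy hgz) (by positivity)
    _ = (∑ y ∈ S, |f y|) * (∑ z ∈ S, |g z|) * B := by
        rw [Finset.sum_mul, Finset.sum_mul]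
        exact Finset.sum_congr rfl fun y _ => by rw [Finset.mul_sum, Finset.sum_mul]

/-- **Registered stub `stub_signedOfSymKernel`** (line «signed-femto-collar», Defs p613181): `SymContactKernelSigR → FBLPinnedSigR →` the signed smooth-collar share of the β-response is
`≤ η(1 + |∂_cQ2|)` for the radial cut-off `χ = F(‖· − p‖) + F(‖· − θp‖)` (`F = 1` on `[0,R/2]`, `= 0` on `[R,∞)`).  Per charged pair
`(y,z)`: the symmetric parts `F(s‖x − z‖)`, `F(s‖x − y‖)` are radial lattice weights (kernel statement, `κ a⁸` each); the offsets
`|F(‖s x − p‖) − F(s‖x − z‖)| ≤ Lip(F)·ρ` live on the shell `R/4 ≤ s‖x − z‖ ≤ 5R/4`, where the FBL-collar bound gives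
`|κ₃| ≤ (2C₁/M⁴)³ ≤ A₀ a¹²` per site and `≤ (5R/a)⁴` sites, so `ρ ≤ κ/(625·Lip(F)·A₀R⁴ + 1)` makes each offset `≤ κ a⁸`; Riemann sums
`s⁴Σ|v(s·)|, s⁴Σ|θv(s·)| ≤ 2` finish: `≤ 16κ = η/4`. [folklore] -/
theorem stub_signedOfSymKernel : SignedOfSymKernelSigR := by
  intro hK hFBL G _ _ _ _ hG
  letI : MeasurableSpace G := borel G
  haveI : BorelSpace G := ⟨rfl⟩
  intro r a hpos hlim p hp0 ε hε η hη Λ hΛ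
  classical
  have hΛ0 : 0 < Λ := by linarith only [hΛ]
  have hp0n : p 0 ≤ ‖p‖ := by
    have h := PiLp.norm_apply_le p (0 : Fin 4)
    rw [Real.norm_eq_abs] at h
    exact (le_abs_self _).trans h
  -- (1) pinning witness
  by_cases hW : ∃ (v₀ : 𝓢(EuclideanSpace ℝ (Fin 4), ℝ)) (ε' β₅ Λ₅ : ℝ), HasCompactSupport v₀ ∧
      tsupport v₀ ⊆ {y : EuclideanSpace ℝ (Fin 4) | 0 < y 0} ∧ 0 < ε' ∧
      ∀ β : ℝ, β₅ ≤ β → ∀ L : ℕ, Λ₅ ≤ a β * L → ε' ≤ Q2 G r β L (a β) (thetaTest 4 v₀) v₀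
  swap
  · refine ⟨p 0 / 2, half_pos hp0, fun v hball hsupp _ hfloor => ?_⟩
    exfalso
    obtain ⟨β₅, Λ₅, hfl⟩ := hfloor
    exact hW ⟨v, ε, β₅, Λ₅, (isCompact_closedBall p (p 0 / 2)).of_isClosed_subset (isClosed_tsupport _) hball,
      hsupp, hε, hfl⟩
  -- (2) FBL along the unit, the kernel at separations `[p₀/Λ, 2‖p‖+p₀]` with `κ = η/64`
  obtain ⟨C₁, β₁, ℓ₁, pβ, hℓ₁, hC₁, hF⟩ := hFBL G hG r a hpos hlim hW
  have hr₁ : 0 < p 0 / Λ := div_pos hp0 hΛ0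
  have hr₁₂ : p 0 / Λ ≤ 2 * ‖p‖ + p 0 := by
    have h1 : p 0 / Λ ≤ p 0 := div_le_self hp0.le hΛ
    linarith only [h1, norm_nonneg p]
  set κ : ℝ := η / 64 with hκdef
  have hκ : 0 < κ := div_pos hη (by norm_num)
  obtain ⟨RK, hRK, β₀, Λ₀, hker⟩ := hK G hG r a hpos hlim hW (p 0 / Λ) (2 * ‖p‖ + p 0) hr₁ hr₁₂ κ hκ
  -- radii and the cut-off profile
  set R : ℝ := min RK (p 0 / 4) with hRdef
  have hR0 : 0 < R := lt_min hRK (div_pos hp0 (by norm_num))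
  have hRRK : R ≤ RK := min_le_left _ _
  have hRp : R ≤ p 0 / 4 := min_le_right _ _
  -- the cut-off `χ = F(‖· − p‖) + F(‖· − θp‖)` (toolkit `exists_signed_cutoff`, source radius up to `R/4`)
  set θp : EuclideanSpace ℝ (Fin 4) := (timeReflection 4) p with hθpdef
  have hθθp : (timeReflection 4) θp = p := timeReflection_timeReflection 4 p
  obtain ⟨F, LF, χf, hLF0, hF0, hF1, hFone, hFzero, hFlip, hχsmooth, hχcpt, hχf, hχ01, hχzero, hχone⟩ :=
    exists_signed_cutoff p hp0 hR0 hRp (le_refl (R / 4))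
  have hFabs : ∀ t, |F t| ≤ 1 := fun t => by rw [abs_of_nonneg (hF0 t)]; exact hF1 t
  set χ : 𝓢(EuclideanSpace ℝ (Fin 4), ℝ) := hχcpt.toSchwartzMap hχsmooth with hχdef
  have hχ_apply : ∀ u, χ u = F ‖u - p‖ + F ‖u - θp‖ := fun u => hχf u
  -- the offset-shell constants
  set cM : ℝ := min (R / (64 * Λ)) (ℓ₁ / 4) with hcMdef
  have hcM0 : 0 < cM := lt_min (div_pos hR0 (by positivity)) (div_pos hℓ₁ (by norm_num))
  have hcMR : cM ≤ R / (64 * Λ) := min_le_left _ _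
  have hcMℓ : cM ≤ ℓ₁ / 4 := min_le_right _ _
  set A₀ : ℝ := (2 * C₁) ^ 3 * 2 ^ 12 / cM ^ 12 with hA₀def
  have hA₀0 : 0 ≤ A₀ := div_nonneg (by positivity) (pow_nonneg hcM0.le 12)
  set ρ : ℝ := min (min (R / 4) 1) (κ / (625 * LF * A₀ * R ^ 4 + 1)) with hρdef
  have hden : 0 < 625 * LF * A₀ * R ^ 4 + 1 :=
    add_pos_of_nonneg_of_pos (mul_nonneg (mul_nonneg (mul_nonneg (by norm_num) hLF0) hA₀0) (pow_nonneg hR0.le 4)) one_pos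
  have hρ0 : 0 < ρ := lt_min (lt_min (div_pos hR0 (by norm_num)) one_pos) (div_pos hκ hden)
  have hρR : ρ ≤ R / 4 := (min_le_left _ _).trans (min_le_left _ _)
  have hρ1 : ρ ≤ 1 := (min_le_left _ _).trans (min_le_right _ _)
  have hρκ : 625 * LF * A₀ * R ^ 4 * ρ ≤ κ := by
    have h1 : ρ ≤ κ / (625 * LF * A₀ * R ^ 4 + 1) := min_le_right _ _
    have h2 : ρ * (625 * LF * A₀ * R ^ 4 + 1) ≤ κ := (le_div_iff₀ hden).1 h1
    nlinarith only [h2, hρ0.le]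
  have hρp2 : ρ ≤ p 0 / 2 := by linarith only [hρR, hRp, hp0]
  refine ⟨ρ, hρ0, fun v hball hsupp hL1 _ => ?_⟩
  -- per source: Riemann thresholds, window data
  set R' : ℝ := ‖p‖ + ρ with hR'
  have hR'0 : 0 ≤ R' := add_nonneg (norm_nonneg p) hρ0.le
  have hvR : tsupport (v : EuclideanSpace ℝ (Fin 4) → ℝ) ⊆ Metric.closedBall 0 R' := by
    refine hball.trans (Metric.closedBall_subset_closedBall' ?_)
    rw [dist_zero_right]; linarith only [hR']
  have hθR := Summit.QuantumFields.YangMills.Cruxes.NT.Reference.tsupport_thetaTest_subset_closedBall_zero hvR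
  obtain ⟨s₁, hs₁, h₁⟩ := exists_latticeSum_abs_le v hvR
  obtain ⟨s₂, hs₂, h₂⟩ := exists_latticeSum_abs_le (thetaTest 4 v) hθR
  set s₀ : ℝ := min (min s₁ s₂) 1 with hs₀
  have hs₀0 : 0 < s₀ := lt_min (lt_min hs₁ hs₂) one_pos
  obtain ⟨β₂, hβ₂⟩ := Filter.eventually_atTop.mp (hlim.eventually (gt_mem_nhds (div_pos hs₀0 hΛ0)))
  set a₀ : ℝ := min (min (cM / 4) (3 * R / (128 * Λ))) (min (ℓ₁ / 6) (R / 2)) with ha₀def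
  have ha₀0 : 0 < a₀ := lt_min (lt_min (div_pos hcM0 (by norm_num)) (div_pos (mul_pos (by norm_num) hR0) (by positivity)))
    (lt_min (div_pos hℓ₁ (by norm_num)) (half_pos hR0))
  obtain ⟨β₃, hβ₃⟩ := Filter.eventually_atTop.mp (hlim.eventually (gt_mem_nhds ha₀0))
  have hθpre := Summit.QuantumFields.YangMills.Cruxes.UVSeamRec.Q3MirrorFloors.tsupport_thetaTest_subset_preimage v
  refine ⟨R / 4, div_pos hR0 (by norm_num), χ, ?_, fun u => hχ01 u, ⟨‖p‖ + R, fun u hu => hχzero u hu⟩,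
    max (max β₀ β₁) (max β₂ β₃), max (max Λ₀ (4 * cM + 8)) (2 * R' + 2 * RK + 2 * R + 2), fun β hβ L hL l hl => ?_⟩
  · -- `χ = 1` on the `R/4`-thickening of `K`
    intro u hu
    obtain ⟨k, hk, hdk⟩ := Metric.mem_thickening_iff.1 hu
    rw [dist_eq_norm] at hdk
    refine hχone u k ?_ hdk
    rcases (Set.mem_union _ _ _).1 hk with hkv | hkθ
    · left
      have := hball hkv; rw [Metric.mem_closedBall, dist_eq_norm] at this; exact this.trans hρR
    · right
      have h1 := hball (hθpre hkθ)
      rw [Metric.mem_closedBall, dist_eq_norm] at h1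
      have e : ‖k - θp‖ = ‖(timeReflection 4) k - p‖ := by
        rw [← (timeReflection 4).norm_map (k - θp), map_sub, hθθp]
      rw [e]; exact h1.trans hρR
  -- thresholds at `(β, L, l)`
  have hβ0 : β₀ ≤ β := le_trans ((le_max_left _ _).trans (le_max_left _ _)) hβ
  have hβ1 : β₁ ≤ β := le_trans ((le_max_right _ _).trans (le_max_left _ _)) hβ
  have hβ2 : β₂ ≤ β := le_trans ((le_max_left _ _).trans (le_max_right _ _)) hβ
  have hβ3 : β₃ ≤ β := le_trans ((le_max_right _ _).trans (le_max_right _ _)) hβ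
  have hLΛ₀ : Λ₀ ≤ a β * L := le_trans ((le_max_left _ _).trans (le_max_left _ _)) hL
  have hLcM : 4 * cM + 8 ≤ a β * L := le_trans ((le_max_right _ _).trans (le_max_left _ _)) hL
  have hLbig : 2 * R' + 2 * RK + 2 * R + 2 ≤ a β * L := le_trans (le_max_right _ _) hL
  have haβ : 0 < a β := hpos β
  have ha₀ : a β < a₀ := hβ₃ β hβ3
  have hacM : a β ≤ cM / 4 := ha₀.le.trans ((min_le_left _ _).trans (min_le_left _ _))
  have ha128 : a β ≤ 3 * R / (128 * Λ) := ha₀.le.trans ((min_le_left _ _).trans (min_le_right _ _))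
  have haℓ : a β ≤ ℓ₁ / 6 := ha₀.le.trans ((min_le_right _ _).trans (min_le_left _ _))
  have haR2 : a β ≤ R / 2 := ha₀.le.trans ((min_le_right _ _).trans (min_le_right _ _))
  clear_value κ R θp χ cM A₀ ρ a₀
  -- the spacing `s = l · aβ`
  set s : ℝ := l * a β with hsdef
  have hl1 : 1 ≤ l := hl.1
  have hs : 0 < s := mul_pos (lt_of_lt_of_le one_pos hl1) haβ
  have hsaβ : a β ≤ s := by
    have := mul_le_mul_of_nonneg_right hl1 haβ.le
    rw [hsdef]; linarith only [this]
  have hsΛ : s ≤ Λ * a β := by rw [hsdef]; exact mul_le_mul_of_nonneg_right hl.2 haβ.le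
  have hss₀ : s ≤ s₀ := by
    have h1 : a β < s₀ / Λ := hβ₂ β hβ2
    have h2 : Λ * a β ≤ Λ * (s₀ / Λ) := mul_le_mul_of_nonneg_left h1.le hΛ0.le
    have h3 : Λ * (s₀ / Λ) = s₀ := by field_simp
    linarith only [hsΛ, h2, h3]
  have hs1 : s ≤ 1 := le_trans hss₀ (min_le_right _ _)
  have hss₁ : s ≤ s₁ := le_trans hss₀ (le_trans (min_le_left _ _) (min_le_left _ _))
  have hss₂ : s ≤ s₂ := le_trans hss₀ (le_trans (min_le_left _ _) (min_le_right _ _))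
  clear_value s₀ s
  have haLsL : a β * L ≤ s * L := mul_le_mul_of_nonneg_right hsaβ (Nat.cast_nonneg L)
  have hsL : 2 * R' ≤ s * L := by linarith only [haLsL, hLbig, hRK, hR0]
  have hRL : R' ≤ s * L := by linarith only [hsL, hR'0]
  -- Riemann sums
  have hSv : s ^ 4 * ∑ z ∈ box 4 L, |v (s • siteToE z)| ≤ 2 := by
    have := h₁ s hs hss₁ L hRL; linarith only [this, hL1]
  have hSθ : s ^ 4 * ∑ y ∈ box 4 L, |(thetaTest 4 v) (s • siteToE y)| ≤ 2 := by
    have := h₂ s hs hss₂ L hRL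
    rw [Summit.QuantumFields.YangMills.Cruxes.NT.CeilingPrice.integral_abs_thetaTest] at this
    linarith only [this, hL1]
  have hSv0 : 0 ≤ ∑ z ∈ box 4 L, |v (s • siteToE z)| := Finset.sum_nonneg fun _ _ => abs_nonneg _
  -- the kernel at `(β, L)` and the radial weight `φ(t) = F(l t)`
  have hkerβ := hker β hβ0 L hLΛ₀
  set φ : ℝ → ℝ := fun t => F (l * t) with hφdef
  have hφ1 : ∀ t, |φ t| ≤ 1 := fun t => hFabs _
  have hφ0 : ∀ t, RK ≤ t → φ t = 0 := by
    intro t ht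
    apply hFzero
    have h1 : 0 ≤ t := hRK.le.trans ht
    have : t ≤ l * t := le_mul_of_one_le_left h1 hl1
    linarith only [this, ht, hRRK]
  clear_value φ
  -- the cube radius of the offset bound
  obtain ⟨hM4, hMle, hMge⟩ := Summit.QuantumFields.YangMills.Cruxes.ResponseLocalisation.Femto.floor_facts haβ hacM
  set M : ℕ := ⌊cM / a β⌋₊ with hMdef
  have hM1 : 1 ≤ M := by omega
  have hMcM : (M : ℝ) * a β ≤ cM := (le_div_iff₀ haβ).1 hMle
  have hcM2M : cM ≤ 2 * (M : ℝ) * a β := by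
    have := (div_le_iff₀ (by positivity : (0 : ℝ) < 2 * a β)).1 hMge
    linarith only [this]
  have hMpos : (0 : ℝ) < M := by exact_mod_cast hM1
  clear_value M
  have hb : ((2 * M + 3 : ℕ) : ℝ) * a β ≤ ℓ₁ := by push_cast; linarith only [hMcM, hcMℓ, haℓ]
  have hML : 4 * M + 8 ≤ L := by
    have h1 : ((4 * M + 8 : ℕ) : ℝ) * a β ≤ (L : ℝ) * a β := by
      push_cast; linarith only [hMcM, hLcM, hsaβ, hs1, haβ.le]
    exact_mod_cast le_of_mul_le_mul_right h1 haβ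
  have hMsep : 2 * (2 * (M : ℝ) + 4) * s ≤ R / 4 := by
    -- `2(2M+4) ≤ R/(4Λ a)` and `s ≤ Λ a`
    have h1 : (M : ℝ) * a β ≤ R / (64 * Λ) := hMcM.trans hcMR
    have h2 : 2 * (2 * (M : ℝ) + 4) * (Λ * a β) ≤ R / 4 := by
      have e1 : 2 * (2 * (M : ℝ) + 4) * (Λ * a β) = 4 * Λ * ((M : ℝ) * a β) + 8 * Λ * a β := by ring
      rw [e1]
      have h3 : 4 * Λ * ((M : ℝ) * a β) ≤ 4 * Λ * (R / (64 * Λ)) := mul_le_mul_of_nonneg_left h1 (by positivity)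
      have h4 : 8 * Λ * a β ≤ 8 * Λ * (3 * R / (128 * Λ)) := mul_le_mul_of_nonneg_left ha128 (by positivity)
      have e2 : 4 * Λ * (R / (64 * Λ)) = R / 16 := by field_simp; ring
      have e3 : 8 * Λ * (3 * R / (128 * Λ)) = 3 * R / 16 := by field_simp; ring
      linarith only [h3, h4, e2, e3]
    have h5 : 2 * (2 * (M : ℝ) + 4) * s ≤ 2 * (2 * (M : ℝ) + 4) * (Λ * a β) :=
      mul_le_mul_of_nonneg_left hsΛ (by positivity)
    linarith only [h2, h5]
  have hA₀M : (2 * C₁ / (M : ℝ) ^ 4) ^ 3 ≤ A₀ * a β ^ 12 := by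
    have hMinv : 1 / (M : ℝ) ≤ 2 * a β / cM := by
      rw [div_le_div_iff₀ hMpos hcM0]; linarith only [hcM2M]
    have hM0 : (M : ℝ) ≠ 0 := hMpos.ne'
    have e1 : (2 * C₁ / (M : ℝ) ^ 4) ^ 3 = (2 * C₁) ^ 3 * (1 / (M : ℝ)) ^ 12 := by
      rw [div_pow, div_pow, one_pow, ← pow_mul]; norm_num [div_eq_mul_inv]
    rw [e1, hA₀def]
    have h12 : (1 / (M : ℝ)) ^ 12 ≤ (2 * a β / cM) ^ 12 := pow_le_pow_left₀ (by positivity) hMinv 12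
    have e2 : (2 * C₁) ^ 3 * (2 * a β / cM) ^ 12 = (2 * C₁) ^ 3 * 2 ^ 12 / cM ^ 12 * a β ^ 12 := by
      rw [div_pow, mul_pow]; ring
    calc (2 * C₁) ^ 3 * (1 / (M : ℝ)) ^ 12 ≤ (2 * C₁) ^ 3 * (2 * a β / cM) ^ 12 :=
          mul_le_mul_of_nonneg_left h12 (by positivity)
      _ = (2 * C₁) ^ 3 * 2 ^ 12 / cM ^ 12 * a β ^ 12 := e2
  -- support points of `v(s·)` and `θv(s·)`
  have hmem_v : ∀ z : Fin 4 → ℤ, v (s • siteToE z) ≠ 0 → z ∈ box 4 L := fun z hz =>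
    Summit.QuantumFields.YangMills.Cruxes.NT.CeilingPrice.mem_box_of_apply_ne_zero hs hvR hRL hz
  have hmem_θ : ∀ y : Fin 4 → ℤ, (thetaTest 4 v) (s • siteToE y) ≠ 0 → y ∈ box 4 L := fun y hy =>
    Summit.QuantumFields.YangMills.Cruxes.NT.CeilingPrice.mem_box_of_apply_ne_zero hs hθR hRL hy
  -- ball inside the box for a point of norm `≤ R'/s`
  have hballbox : ∀ z : Fin 4 → ℤ, ‖s • siteToE z‖ ≤ R' → ∀ w : Fin 4 → ℤ, a β * ‖siteToE w‖ < RK → z + w ∈ box 4 L :=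
    fun z hz w hw => add_mem_box hs haβ hsaβ (by linarith only [hLbig, hR0, hR'0, hRK]) z hz w hw
  -- (3) the per-pair bound: for a charged pair `(y, z)`, `|Σ_x χ(s x) κ₃(x,y,z)| ≤ 4κ a⁸`
  have hpair : ∀ y z : Fin 4 → ℤ, (thetaTest 4 v) (s • siteToE y) ≠ 0 → v (s • siteToE z) ≠ 0 →
      |∑ x ∈ box 4 L, (F ‖s • siteToE x - p‖ + F ‖s • siteToE x - θp‖) * torusK3 G r β L x y z| ≤ 4 * κ * (a β) ^ 8 := by
    intro y z hθy hvz
    have hy := hmem_θ y hθy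
    have hz := hmem_v z hvz
    obtain ⟨hy1, hy2, hz1, hz2, hyR, hzR⟩ := pair_coords (s := s) hball hθy hvz
    -- torus separation of the pair in units `a`
    have hlow : 2 * (p 0 / 2) ≤ s * ((z 0 : ℝ) - y 0) := by
      have : s * ((z 0 : ℝ) - y 0) = s * z 0 + -(s * y 0) := by ring
      rw [this]; linarith only [hy1, hz1, hρp2]
    have hup : s * ((z 0 : ℝ) - y 0) ≤ 2 * R' := by
      have : s * ((z 0 : ℝ) - y 0) = s * z 0 + -(s * y 0) := by ring
      rw [this, hR']; linarith only [hy2, hz2, hp0n]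
    obtain ⟨hd1, hd2⟩ := pair_torusDist hs (by positivity : (0 : ℝ) < p 0 / 2) hlow hup hyR hzR hsL
    have hdnn : 0 ≤ torusDist L y z := torusDist_nonneg L y z
    have hsep1 : p 0 / Λ ≤ a β * torusDist L y z := by
      rw [div_le_iff₀ hΛ0]
      have : torusDist L y z * s ≤ torusDist L y z * (Λ * a β) := mul_le_mul_of_nonneg_left hsΛ hdnn
      linarith only [this, hd1]
    have hsep2 : a β * torusDist L y z ≤ 2 * ‖p‖ + p 0 := by
      have : a β * torusDist L y z ≤ s * torusDist L y z := mul_le_mul_of_nonneg_right hsaβ hdnn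
      have h3 : 2 * R' ≤ 2 * ‖p‖ + p 0 := by rw [hR']; linarith only [hρp2]
      linarith only [this, h3, hd2, mul_comm s (torusDist L y z)]
    have hsep1' : p 0 / Λ ≤ a β * torusDist L z y := by rw [torusDist_comm L z y]; exact hsep1
    have hsep2' : a β * torusDist L z y ≤ 2 * ‖p‖ + p 0 := by rw [torusDist_comm L z y]; exact hsep2
    -- the charged points in the balls
    have hzball : ‖s • siteToE z - p‖ ≤ ρ := by
      have := hball (subset_tsupport _ (Function.mem_support.2 hvz))
      rwa [Metric.mem_closedBall, dist_eq_norm] at this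
    have hyball : ‖s • siteToE y - θp‖ ≤ ρ := by
      have h1 := hball (hθpre (subset_tsupport _ (Function.mem_support.2 hθy)))
      rw [Metric.mem_closedBall, dist_eq_norm] at h1
      have e : ‖s • siteToE y - θp‖ = ‖(timeReflection 4) (s • siteToE y) - p‖ := by
        rw [← (timeReflection 4).norm_map (s • siteToE y - θp), map_sub, hθθp]
      rw [e]; exact h1
    -- time coordinates: `s(z₀ − y₀) ≥ p₀ ≥ 4R`
    have htime : 4 * R ≤ s * ((z 0 : ℝ) - y 0) := by linarith only [hlow, hRp]
    have htime' : s * ((z 0 : ℝ) - y 0) ≤ 2 * R' := hup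
    have hzy0 : (0 : ℝ) ≤ (z 0 : ℝ) - y 0 :=
      le_of_mul_le_mul_left (by rw [mul_zero]; linarith only [htime, hR0]) hs
    -- (T1) symmetric part about `z`
    have hT1 : |∑ x ∈ box 4 L, φ (a β * ‖siteToE (x - z)‖) * torusK3 G r β L x y z| ≤ κ * (a β) ^ 8 :=
      hkerβ y hy z hz hsep1 hsep2 (hballbox z hzR) φ hφ1 hφ0
    -- (T2) symmetric part about `y` (swap the near/far roles)
    have hT2 : |∑ x ∈ box 4 L, φ (a β * ‖siteToE (x - y)‖) * torusK3 G r β L x y z| ≤ κ * (a β) ^ 8 := by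
      have e : ∑ x ∈ box 4 L, φ (a β * ‖siteToE (x - y)‖) * torusK3 G r β L x y z =
          ∑ x ∈ box 4 L, φ (a β * ‖siteToE (x - y)‖) * torusK3 G r β L x z y :=
        Finset.sum_congr rfl fun x _ => by rw [torusK3_swap G r β L x y z]
      rw [e]
      exact hkerβ z hz y hy hsep1' hsep2' (hballbox y hyR) φ hφ1 hφ0
    -- the FBL-collar per-site bound on the two shells (toolkit `abs_torusK3_le_shell`)
    have hbox : 5 * R / 4 + 2 * R' ≤ s * L := by linarith only [hLbig, haLsL, hRK, hR0]
    have habs_zy : |((z 0 : ℤ) : ℝ) - y 0| = (z 0 : ℝ) - y 0 := abs_of_nonneg hzy0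
    have htimeA : 4 * R ≤ s * |((z 0 : ℤ) : ℝ) - y 0| := by rw [habs_zy]; exact htime
    have htimeA' : s * |((z 0 : ℤ) : ℝ) - y 0| ≤ 2 * R' := by rw [habs_zy]; exact htime'
    have htimeB : 4 * R ≤ s * |((y 0 : ℤ) : ℝ) - z 0| := by rw [abs_sub_comm]; exact htimeA
    have htimeB' : s * |((y 0 : ℤ) : ℝ) - z 0| ≤ 2 * R' := by rw [abs_sub_comm]; exact htimeA'
    have hK3z : ∀ x : Fin 4 → ℤ, R / 4 ≤ s * ‖siteToE (x - z)‖ → s * ‖siteToE (x - z)‖ ≤ 5 * R / 4 →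
        |torusK3 G r β L x y z| ≤ A₀ * a β ^ 12 := fun x hlo hhi =>
      (abs_torusK3_le_shell G r β hC₁ (hF β hβ1) hM1 hb hML hs hR0 hMsep hbox x z y htimeA htimeA' hlo hhi).2.trans hA₀M
    have hK3y : ∀ x : Fin 4 → ℤ, R / 4 ≤ s * ‖siteToE (x - y)‖ → s * ‖siteToE (x - y)‖ ≤ 5 * R / 4 →
        |torusK3 G r β L x y z| ≤ A₀ * a β ^ 12 := fun x hlo hhi =>
      (abs_torusK3_le_shell G r β hC₁ (hF β hβ1) hM1 hb hML hs hR0 hMsep hbox x y z htimeB htimeB' hlo hhi).1.trans hA₀M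
    -- counting the shells: `≤ (5R/a)⁴` sites
    have hcount : ∀ w : Fin 4 → ℤ, ((((box 4 L).filter fun x => ‖siteToE (x - w)‖ ≤ 5 * R / (4 * s)).card : ℕ) : ℝ) ≤
        (5 * R / a β) ^ 4 := fun w => card_shell_le (box 4 L) w haβ hsaβ hR0 haR2
    have hoffset_arith : (5 * R / a β) ^ 4 * (LF * ρ * (A₀ * a β ^ 12)) ≤ κ * a β ^ 8 := by
      have e : (5 * R / a β) ^ 4 * (LF * ρ * (A₀ * a β ^ 12)) = (625 * LF * A₀ * R ^ 4 * ρ) * a β ^ 8 := by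
        rw [div_pow, div_mul_eq_mul_div, div_eq_iff (pow_ne_zero 4 haβ.ne')]
        ring
      rw [e]; exact mul_le_mul_of_nonneg_right hρκ (by positivity)
    -- (T3), (T4): the offset sums (toolkit `sum_abs_offset_le`)
    have eφ : ∀ w : Fin 4 → ℤ, φ (a β * ‖siteToE w‖) = F (s * ‖siteToE w‖) := by
      intro w; simp only [hφdef, hsdef]; ring_nf
    have hT3 : |∑ x ∈ box 4 L, (F ‖s • siteToE x - p‖ - F (s * ‖siteToE (x - z)‖)) * torusK3 G r β L x y z| ≤
        κ * (a β) ^ 8 := by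
      refine (Finset.abs_sum_le_sum_abs _ _).trans ?_
      refine (sum_abs_offset_le (box 4 L) (fun x => torusK3 G r β L x y z) p z hLF0 hFone hFzero hFlip hs hρ0.le hρR
        (by positivity) hzball (fun x _ hlo hhi => hK3z x hlo hhi)).trans ?_
      exact (mul_le_mul_of_nonneg_right (hcount z) (by positivity)).trans hoffset_arith
    have hT4 : |∑ x ∈ box 4 L, (F ‖s • siteToE x - θp‖ - F (s * ‖siteToE (x - y)‖)) * torusK3 G r β L x y z| ≤
        κ * (a β) ^ 8 := by
      refine (Finset.abs_sum_le_sum_abs _ _).trans ?_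
      refine (sum_abs_offset_le (box 4 L) (fun x => torusK3 G r β L x y z) θp y hLF0 hFone hFzero hFlip hs hρ0.le hρR
        (by positivity) hyball (fun x _ hlo hhi => hK3y x hlo hhi)).trans ?_
      exact (mul_le_mul_of_nonneg_right (hcount y) (by positivity)).trans hoffset_arith
    -- decomposition of the cut-off and the four bounds
    have hdec : ∀ x : Fin 4 → ℤ, (F ‖s • siteToE x - p‖ + F ‖s • siteToE x - θp‖) * torusK3 G r β L x y z =
        φ (a β * ‖siteToE (x - z)‖) * torusK3 G r β L x y z + φ (a β * ‖siteToE (x - y)‖) * torusK3 G r β L x y z +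
        ((F ‖s • siteToE x - p‖ - F (s * ‖siteToE (x - z)‖)) * torusK3 G r β L x y z +
         (F ‖s • siteToE x - θp‖ - F (s * ‖siteToE (x - y)‖)) * torusK3 G r β L x y z) := fun x => by
      rw [eφ, eφ]; ring
    rw [Finset.sum_congr rfl fun x _ => hdec x, Finset.sum_add_distrib, Finset.sum_add_distrib, Finset.sum_add_distrib]
    refine (abs_add_le _ _).trans ?_
    have h12 := (abs_add_le _ _).trans (add_le_add hT1 hT2)
    have h34 := (abs_add_le _ _).trans (add_le_add hT3 hT4)
    linarith only [h12, h34]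
  -- (4) smearing: `Σ_x χ(s x) Σ_{y,z} θv v κ₃ = Σ_{y,z} θv v Σ_x χ κ₃` and the Riemann bounds
  have hswap : ∑ x ∈ box 4 L, χ (s • siteToE x) *
        ∑ y ∈ box 4 L, ∑ z ∈ box 4 L, (thetaTest 4 v) (s • siteToE y) * v (s • siteToE z) * torusK3 G r β L x y z =
      ∑ y ∈ box 4 L, ∑ z ∈ box 4 L, (thetaTest 4 v) (s • siteToE y) * v (s • siteToE z) *
        ∑ x ∈ box 4 L, (F ‖s • siteToE x - p‖ + F ‖s • siteToE x - θp‖) * torusK3 G r β L x y z := by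
    simp only [hχ_apply, Finset.mul_sum]
    rw [Finset.sum_comm]
    refine Finset.sum_congr rfl fun y _ => ?_
    rw [Finset.sum_comm]
    refine Finset.sum_congr rfl fun z _ => Finset.sum_congr rfl fun x _ => by ring
  rw [hswap]
  have hs4 : 0 < s ^ 4 := by positivity
  refine (abs_sum_sum_mul_mul_le (box 4 L) (fun y => (thetaTest 4 v) (s • siteToE y)) (fun z => v (s • siteToE z))
    (fun y z => ∑ x ∈ box 4 L, (F ‖s • siteToE x - p‖ + F ‖s • siteToE x - θp‖) * torusK3 G r β L x y z)
    fun y _ z _ hθy hvz => hpair y z hθy hvz).trans ?_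
  beta_reduce
  calc (∑ y ∈ box 4 L, |(thetaTest 4 v) (s • siteToE y)|) * (∑ z ∈ box 4 L, |v (s • siteToE z)|) * (4 * κ * (a β) ^ 8)
      ≤ (2 / s ^ 4) * (2 / s ^ 4) * (4 * κ * (a β) ^ 8) := by
        have h1 : (∑ y ∈ box 4 L, |(thetaTest 4 v) (s • siteToE y)|) ≤ 2 / s ^ 4 := by
          rw [le_div_iff₀ hs4]; linarith only [hSθ, mul_comm (s ^ 4) (∑ y ∈ box 4 L, |(thetaTest 4 v) (s • siteToE y)|)]
        have h2 : (∑ z ∈ box 4 L, |v (s • siteToE z)|) ≤ 2 / s ^ 4 := by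
          rw [le_div_iff₀ hs4]; linarith only [hSv, mul_comm (s ^ 4) (∑ z ∈ box 4 L, |v (s • siteToE z)|)]
        exact mul_le_mul_of_nonneg_right (mul_le_mul h1 h2 hSv0 (by positivity)) (by positivity)
    _ = η / 4 * ((a β) ^ 8 / s ^ 8) := by rw [hκdef]; field_simp; ring
    _ ≤ η / 4 * 1 := by
        refine mul_le_mul_of_nonneg_left ?_ (by positivity)
        rw [div_le_one (by positivity)]
        exact pow_le_pow_left₀ haβ.le hsaβ 8
    _ ≤ η * (1 + |deriv (fun c : ℝ => Q2 G r c L s (thetaTest 4 v) v) β|) := by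
        have hD := mul_nonneg hη.le (abs_nonneg (deriv (fun c : ℝ => Q2 G r c L s (thetaTest 4 v) v) β))
        linarith only [hD, hη]


end Summit.QuantumFields.YangMills.Cruxes.ResponseLocalisation.Signed

end
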